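import Summits.HodgeConjecture.HodgeConjecture.Theorems.Ring2WeilCoverageCMFieldNormResidueSymbolsLocal
import HarnessLib

/-!
# Ring 2 — Weil-family coverage, CM-field rows: the local symbol `(q, θ)_v` at a non-dyadic place where `θ` is a
  UNIFORMISER (ramified in `E`) — the «unit residue» half of cell (ix′) (WEIL-FAMILY-COVERAGE «## b03», part 5)

research route conditional on HC_CM; not a corollary; Q11.4-sentence-2 already refuted in dim ≥ 3.

Sequel of `Ring2WeilCoverageCMFieldNormResidueSymbolsLocal` (inert/split places `v ∤ 2θ`).  The remaining finite places
of `F = ℚ(θ) ⊂ E = F(√θ)` in the census tables are those dividing `2θ`; at a NON-DYADIC place `v` with `ord_v θ = 1`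
(`θ` a uniformiser at `v`, so `v` is ramified in `E`; e.g. `(√5)` for `ℚ(ζ₅)`, `θ = -(5+√5)/2`, or the inert-in-`F`
prime `3` for `ℚ(√-3,√5)`, `θ = -3((1+√5)/2)²`) §b03.19 (ix′) says «the ramified part needs the unit residue».  From the
tree's O'Meara 63:12 (`hilbertSymbol_uniformizer_mul_iff`, `hilbertSymbol_uniformizer_mul_uniformizer_mul_iff`,
`HilbertSymbolNonDyadic`) [cite: Omeara1963, §63 Example 63:12]:

* `hilbertSymbol_adicCompletion_unit_root_eq_neg_one_iff_of_uniformizer` — for a `v`-unit `u`: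
  `(u, θ)_v = -1 ⟺ u` is a NON-SQUARE mod `v` (the Legendre symbol of the unit residue);
* `hilbertSymbol_adicCompletion_root_mul_unit_eq_neg_one_iff_of_uniformizer` — for `q = θu`, `u` a `v`-unit:
  `(θu, θ)_v = -1 ⟺ -u` is a non-square mod `v`;
* the `T`-set memberships and the row consequence `mk_unit_ne_splitDiscriminantClassCM_of_not_isSquare_residue`:
  a `v`-unit `u` which is a non-square mod `v` has `[u] ≠ [(-1)^k]` for `k` even — the «ramified unit classes» of
  §b03.12/§b03.13 for every carrier at once.
[cite: Deligne1982HodgeCycles, §4: display (1) and Cor. 4.2]  No new definition, no named fact, no sorry.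
-/

noncomputable section

set_option linter.dupNamespace false

open Polynomial NumberField IsDedekindDomain

namespace Summit.HodgeConjecture.HodgeConjecture.Ring2.WeilCoverageCM

open Literature.AlgebraicGeometry.Deligne1982
open Literature.AlgebraicGeometry.HodgeTheory (splitDiscriminantClassCM)
open Literature.NumberTheory.QuadraticForms

variable {R : Polynomial ℤ} [Fact (Irreducible (cmPolyQ R))] [Fact (Irreducible (realPolyQ R))]

omit [Fact (Irreducible (cmPolyQ R))] in
/-- **RAMIFIED non-dyadic place, unit argument: `(u, θ)_v = -1 ⟺ u` is a non-square mod `v`** (`v ∤ 2`, `θ` a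
uniformiser at `v`, `u ∈ 𝓞_F` a `v`-unit; O'Meara 63:12 «`(π, δ)_𝔭 = 1` iff `δ` is a square»).
[cite: Omeara1963, §63 Example 63:12] -/
theorem hilbertSymbol_adicCompletion_unit_root_eq_neg_one_iff_of_uniformizer {θₒ : 𝓞 (realField R)}
    (hθ : (θₒ : realField R) = AdjoinRoot.root (realPolyQ R)) (v : HeightOneSpectrum (𝓞 (realField R)))
    (h2 : (2 : 𝓞 (realField R)) ∉ v.asIdeal) (hθ1 : v.intValuation θₒ = WithZero.exp (-1 : ℤ))
    {u : 𝓞 (realField R)} (hu : u ∉ v.asIdeal) :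
    hilbertSymbol (v.adicCompletion (realField R)) (algebraMap (realField R) _ (u : realField R))
        (algebraMap (realField R) _ (AdjoinRoot.root (realPolyQ R))) = -1 ↔
      ¬ IsSquare (Ideal.Quotient.mk v.asIdeal u) := by
  have hθ' : algebraMap (realField R) (v.adicCompletion (realField R)) (AdjoinRoot.root (realPolyQ R)) =
      algebraMap (𝓞 (realField R)) (v.adicCompletion (realField R)) (θₒ * 1) := by
    rw [mul_one, IsScalarTower.algebraMap_apply (𝓞 (realField R)) (realField R) (v.adicCompletion (realField R)),
      ← hθ]
  have hu' : algebraMap (realField R) (v.adicCompletion (realField R)) (u : realField R) =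
      algebraMap (𝓞 (realField R)) (v.adicCompletion (realField R)) u :=
    (IsScalarTower.algebraMap_apply (𝓞 (realField R)) (realField R) (v.adicCompletion (realField R)) u).symm
  have h1 : (1 : 𝓞 (realField R)) ∉ v.asIdeal := fun h ↦ v.isPrime.ne_top ((Ideal.eq_top_iff_one _).2 h)
  rw [hθ', hu', hilbertSymbol_comm, ← hilbertSymbol_ne_one_iff, Ne]
  exact not_congr (hilbertSymbol_uniformizer_mul_iff (realField R) v h2 hθ1 h1 hu)

omit [Fact (Irreducible (cmPolyQ R))] in
/-- **RAMIFIED non-dyadic place, argument `θu`: `(θu, θ)_v = -1 ⟺ -u` is a non-square mod `v`** (`v ∤ 2`, `θ` a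
uniformiser at `v`, `u` a `v`-unit; O'Meara 63:12: `(πa, πb)_𝔭 = 1` iff `-ab` is a square).
[cite: Omeara1963, §63 Example 63:12] -/
theorem hilbertSymbol_adicCompletion_root_mul_unit_eq_neg_one_iff_of_uniformizer {θₒ : 𝓞 (realField R)}
    (hθ : (θₒ : realField R) = AdjoinRoot.root (realPolyQ R)) (v : HeightOneSpectrum (𝓞 (realField R)))
    (h2 : (2 : 𝓞 (realField R)) ∉ v.asIdeal) (hθ1 : v.intValuation θₒ = WithZero.exp (-1 : ℤ))
    {u : 𝓞 (realField R)} (hu : u ∉ v.asIdeal) :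
    hilbertSymbol (v.adicCompletion (realField R))
        (algebraMap (realField R) _ (AdjoinRoot.root (realPolyQ R) * (u : realField R)))
        (algebraMap (realField R) _ (AdjoinRoot.root (realPolyQ R))) = -1 ↔
      ¬ IsSquare (Ideal.Quotient.mk v.asIdeal (-u)) := by
  have hθ' : algebraMap (realField R) (v.adicCompletion (realField R)) (AdjoinRoot.root (realPolyQ R)) =
      algebraMap (𝓞 (realField R)) (v.adicCompletion (realField R)) θₒ := by
    rw [IsScalarTower.algebraMap_apply (𝓞 (realField R)) (realField R) (v.adicCompletion (realField R)), ← hθ]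
  have hθu : algebraMap (realField R) (v.adicCompletion (realField R))
      (AdjoinRoot.root (realPolyQ R) * (u : realField R)) =
      algebraMap (𝓞 (realField R)) (v.adicCompletion (realField R)) (θₒ * u) := by
    rw [IsScalarTower.algebraMap_apply (𝓞 (realField R)) (realField R) (v.adicCompletion (realField R)),
      map_mul (algebraMap (𝓞 (realField R)) (realField R)), ← hθ]
  have h1 : (1 : 𝓞 (realField R)) ∉ v.asIdeal := fun h ↦ v.isPrime.ne_top ((Ideal.eq_top_iff_one _).2 h)
  have e := hilbertSymbol_uniformizer_mul_uniformizer_mul_iff (realField R) v h2 hθ1 hu h1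
  simp only [mul_one] at e
  rw [hθ', hθu, ← hilbertSymbol_ne_one_iff, Ne]
  exact not_congr e

omit [Fact (Irreducible (cmPolyQ R))] in
/-- **Membership of a ramified non-dyadic place in `T(u)`, `u` a `v`-unit: `v ∈ T(u) ⟺ u` non-square mod `v`.**
[cite: Omeara1963, §63 Example 63:12] [cite: Deligne1982HodgeCycles, §4 (1)] -/
theorem inl_mem_badPlaces_unit_iff_of_uniformizer {θₒ : 𝓞 (realField R)}
    (hθ : (θₒ : realField R) = AdjoinRoot.root (realPolyQ R)) (v : HeightOneSpectrum (𝓞 (realField R)))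
    (h2 : (2 : 𝓞 (realField R)) ∉ v.asIdeal) (hθ1 : v.intValuation θₒ = WithZero.exp (-1 : ℤ))
    {u : 𝓞 (realField R)} (hu : u ∉ v.asIdeal) :
    Sum.inl v ∈ badPlaces (u : realField R) (AdjoinRoot.root (realPolyQ R)) ↔
      ¬ IsSquare (Ideal.Quotient.mk v.asIdeal u) := by
  rw [mem_badPlaces_iff, placeSymbol_inl,
    hilbertSymbol_adicCompletion_unit_root_eq_neg_one_iff_of_uniformizer hθ v h2 hθ1 hu]

omit [Fact (Irreducible (cmPolyQ R))] in
/-- **Membership of a ramified non-dyadic place in `T(θu)`, `u` a `v`-unit: `v ∈ T(θu) ⟺ -u` non-square mod `v`.**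
[cite: Omeara1963, §63 Example 63:12] [cite: Deligne1982HodgeCycles, §4 (1)] -/
theorem inl_mem_badPlaces_root_mul_unit_iff_of_uniformizer {θₒ : 𝓞 (realField R)}
    (hθ : (θₒ : realField R) = AdjoinRoot.root (realPolyQ R)) (v : HeightOneSpectrum (𝓞 (realField R)))
    (h2 : (2 : 𝓞 (realField R)) ∉ v.asIdeal) (hθ1 : v.intValuation θₒ = WithZero.exp (-1 : ℤ))
    {u : 𝓞 (realField R)} (hu : u ∉ v.asIdeal) :
    Sum.inl v ∈ badPlaces (AdjoinRoot.root (realPolyQ R) * (u : realField R)) (AdjoinRoot.root (realPolyQ R)) ↔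
      ¬ IsSquare (Ideal.Quotient.mk v.asIdeal (-u)) := by
  rw [mem_badPlaces_iff, placeSymbol_inl,
    hilbertSymbol_adicCompletion_root_mul_unit_eq_neg_one_iff_of_uniformizer hθ v h2 hθ1 hu]

/-- **The «ramified unit classes», uniformly**: at a non-dyadic place `v` of `F` where `θ` is a uniformiser
(`v` ramified in `E`), a `v`-unit `u ∈ 𝓞_F` which is a NON-SQUARE mod `v` satisfies `[u] ≠ [(-1)^k]` for every even
`k` (`v ∈ T(u)`, `v ∉ T(1)`): the unit rows of §b03.12/§b03.13 (e.g. `ℚ(ζ₅)` at `(√5)`, `ℚ(√-3,√5)` at `3`) for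
every carrier at once. [cite: Deligne1982HodgeCycles, §4 (1) and Cor. 4.2] [cite: Omeara1963, §63 Example 63:12] -/
theorem mk_unit_ne_splitDiscriminantClassCM_of_not_isSquare_residue {θₒ : 𝓞 (realField R)}
    (hθ : (θₒ : realField R) = AdjoinRoot.root (realPolyQ R)) (v : HeightOneSpectrum (𝓞 (realField R)))
    (h2 : (2 : 𝓞 (realField R)) ∉ v.asIdeal) (hθ1 : v.intValuation θₒ = WithZero.exp (-1 : ℤ))
    {u : 𝓞 (realField R)} (hu : u ∉ v.asIdeal) (hns : ¬ IsSquare (Ideal.Quotient.mk v.asIdeal u))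
    (q : (realField R)ˣ) (hq : (q : realField R) = (u : realField R)) {k : ℕ} (hk : Even k) :
    (QuotientGroup.mk q : cmNormResidueGroup R) ≠ splitDiscriminantClassCM R k := by
  intro h
  rw [mk_eq_splitDiscriminantClassCM_iff_badPlaces_eq_empty q hk, hq] at h
  have hv := (inl_mem_badPlaces_unit_iff_of_uniformizer hθ v h2 hθ1 hu).2 hns
  rw [h] at hv
  exact hv

/-- **Distinct rows by unit residues**: two `v`-units `u, u'` (`v` non-dyadic, `θ` a uniformiser at `v`) with
`u` a non-square and `u'` a square mod `v` give different classes `[u] ≠ [u']`.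
[cite: Deligne1982HodgeCycles, §4 (1) and Prop. 4.1] [cite: Omeara1963, §63 Example 63:12] -/
theorem mk_unit_ne_mk_unit_of_isSquare_residue {θₒ : 𝓞 (realField R)}
    (hθ : (θₒ : realField R) = AdjoinRoot.root (realPolyQ R)) (v : HeightOneSpectrum (𝓞 (realField R)))
    (h2 : (2 : 𝓞 (realField R)) ∉ v.asIdeal) (hθ1 : v.intValuation θₒ = WithZero.exp (-1 : ℤ))
    {u u' : 𝓞 (realField R)} (hu : u ∉ v.asIdeal) (hu' : u' ∉ v.asIdeal)
    (hns : ¬ IsSquare (Ideal.Quotient.mk v.asIdeal u)) (hsq : IsSquare (Ideal.Quotient.mk v.asIdeal u'))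
    (q q' : (realField R)ˣ) (hq : (q : realField R) = (u : realField R))
    (hq' : (q' : realField R) = (u' : realField R)) :
    (QuotientGroup.mk q : cmNormResidueGroup R) ≠ QuotientGroup.mk q' := by
  intro h
  rw [mk_eq_mk_iff_badPlaces_eq, hq, hq'] at h
  have hv := (inl_mem_badPlaces_unit_iff_of_uniformizer hθ v h2 hθ1 hu).2 hns
  rw [h, inl_mem_badPlaces_unit_iff_of_uniformizer hθ v h2 hθ1 hu'] at hv
  exact hv hsq

end Summit.HodgeConjecture.HodgeConjecture.Ring2.WeilCoverageCM

end
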